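import Literature.Computability.AlgebraicComplexity.MS21ReadOnceOrbitHittingProofs
import Literature.Computability.AlgebraicComplexity.MS21ContinuantHittingSetProofs
import HarnessLib

/-!
# Medini–Shpilka 2021, Cor 34: a hitting set of size `n^{O(log n)}` for the affine orbits of
# read-once formulas (`MS2021_cor_34_holds`)

Theorem-only companion of `MS21DenseOrbitsHittingSets.lean` (cell `val-lit`, seat t18 g5): a PROOF
of the typed fact `MS2021_cor_34` (existence-and-size form: one constant `c` such that over every
field with `|F| ≥ n²`, or infinite, a set of `≤ n^{c(⌊log₂ n⌋ + 1)} + c` points hits every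
`0 ≠ f ∈ ROF^{GLaff_n(F)}`), with `c = 64`, following the printed one-line proof "As before,
(cor:PITROPINV) follows immediately from (thm:PITROPINV) and (obsHitSetGen)"
[MediniShpilka2021, arXiv p0026:L48]:

* (thm:PITROPINV) = Thm 33 in the STRONGER form its printed proof gives, for a read-once formula on
  ANY number `m ≤ 2^t` of leaves (`MS2021.totalDegree_bind₁_affSubst_ne_zero_of_isROP`, tree file
  `MS21ReadOnceOrbitHittingProofs.lean`), packaged here as `MS2021.bind₁_ne_zero_of_isROP_of_mem_affOrbit`;
  with `t = ⌊log₂ n⌋ + 1` every `m ≤ n < 2^t` is covered, so a `(⌊log₂ n⌋ + 2)`-independent map hits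
  the whole class `rofAffOrbits K n`;
* the `(⌊log₂ n⌋ + 2)`-independent map = `⌊log₂ n⌋ + 2` variable-disjoint copies of the uniform
  SV-generator block `Ĝ_i(y_1, y_2, z) = c_i · z · ∏_{j ≠ i} (y_1 - α_j y_2)` of Def 3.4 (tree:
  `MS2021.svGenHom₁_spec`, `MS2021.svGenHom₁_degreeOf` of `MS21ContinuantHittingSetProofs.lean`,
  seat x6 g3; Def 19: "a sum of `k` variable-disjoint `1`-independent polynomial maps");
* (obsHitSetGen) = Obs 18 (arXiv Obs 1.14): a nonzero polynomial with individual degrees `< |W_v|`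
  does not vanish on the grid `∏_v W_v` (Mathlib `MvPolynomial.eq_zero_of_eval_zero_at_prod_finset`),
  with `|W| = n(n-1) + 1 ≤ n²` for the control variables and `|W_z| = n + 1` for the `z`-variables
  (`deg f ≤ m ≤ n`, individual degrees of the block `≤ n - 1` resp. `≤ 1`, `MS2021.degreeOf_bind₁_le`);
  the grid has `3(⌊log₂ n⌋ + 2)` coordinates of size `≤ 2n²`, whence `|H| ≤ (2n²)^{3(⌊log₂ n⌋ + 2)}
  ≤ n^{64(⌊log₂ n⌋ + 1)} + 64` (crude; `n = 1` uses the additive slack).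

No new definitions, no new facts (D-0026): net debt `−1`. HONEST FRAMING: existence with the printed
size only ("explicit" was dropped when typing — flagged WEAKER there); `VP ≠ VNP` is NOT proved.

## References
* [MediniShpilka2021] D. Medini, A. Shpilka, CCC 2021 (LIPIcs 200:19): Cor 34 (p.19:13) and its
  proof (arXiv:2102.05632 §5.1, held text p0026:L48), Thm 33, Def 3.2 / Def 3.4 / Obs 3.5
  (p0017:L22-L47), Def 19, Obs 18 = arXiv Obs 1.14 (p0006:L58-L63).
-/

noncomputable section

open MvPolynomial Matrix

namespace Literature.Computability.AlgebraicComplexity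

namespace MS2021

/-! ### Thm 33 for every leaf count (the stronger printed claim, packaged) -/

section Thm33All

variable {K : Type*} [Field K] {m n t c : ℕ}

/-- **Thm 33 for a read-once formula on any `m ≤ 2^t` leaves** (the stronger claim of the printed
proof: "Let `Φ` be a ROF on `m ≤ 2^t` many variables … `f ∘ G` is a non-constant polynomial"; a
nonzero constant `f` is trivially preserved): `0 ≠ f ∈ Φ^{GLaff_n(F)}` and `G` `(t+1)`-independent
`⇒ f ∘ G ≠ 0`. [cite: MediniShpilka2021, §5.1 proof of Thm 33 (arXiv p0026:L32-L34)] -/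
theorem bind₁_ne_zero_of_isROP_of_mem_affOrbit {S : Finset (Fin m)} {g : MvPolynomial (Fin m) K}
    (hg : IsROP S g) (hS : S.card ≤ 2 ^ t) {f : MvPolynomial (Fin n) K} (hf : f ∈ affOrbit n g)
    (hf0 : f ≠ 0) {G : Fin n → MvPolynomial (Fin (t + 1) × (Fin c ⊕ Unit)) K}
    (hG : IsIndependent (t + 1) G) : bind₁ G f ≠ 0 := by
  classical
  obtain ⟨h, A, b, hA, rfl⟩ := hf
  by_cases hdeg : g.totalDegree = 0
  · rw [totalDegree_eq_zero_iff_eq_C] at hdeg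
    rw [hdeg, affSubst_C] at hf0 ⊢
    rw [bind₁_C_right, Ne, C_eq_zero]
    rw [Ne, C_eq_zero] at hf0
    exact hf0
  · have key := totalDegree_bind₁_affSubst_ne_zero_of_isROP S.card S g hg le_rfl t c n h A b hA hS
      hdeg G hG
    intro h0
    rw [h0, totalDegree_zero] at key
    exact key rfl

/-- Degree of a member of `ROF^{GLaff_n(F)}`: at most the number of leaves, hence `≤ n`
("Read-once polynomials are always multilinear polynomials").
[cite: MediniShpilka2021, remark after Def 5 (arXiv p0025:L13); §1.2.2 (CCC p.19:12)] -/
theorem totalDegree_le_of_mem_rofAffOrbits {f : MvPolynomial (Fin n) K}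
    (hf : f ∈ rofAffOrbits K n) : f.totalDegree ≤ n := by
  obtain ⟨m, S, g, hg, h, A, b, -, rfl⟩ := hf
  calc (affSubst h A b g).totalDegree ≤ g.totalDegree := totalDegree_affSubst_le h A b g
    _ ≤ S.card := hg.totalDegree_le_card
    _ ≤ m := by simpa using Finset.card_le_univ S
    _ ≤ n := h

end Thm33All

/-! ### `k` variable-disjoint copies of the uniform SV block (Def 19 / Def 3.4) -/

section Blocks

variable {K : Type*} [Field K] {n k : ℕ} {τ : Type*}

/-- Individual degrees of an embedded block: `deg_{(l, v)} (p` renamed into block `l') ≤ deg_v p`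
(equality for `l' = l`, zero otherwise — the blocks are variable-disjoint).
[cite: MediniShpilka2021, Def 19 ("a sum of `k` variable-disjoint `1`-independent polynomial maps"; arXiv p0006:L65)] -/
theorem degreeOf_rename_prodMk_le (l l' : Fin k) (v : τ) (p : MvPolynomial τ K) :
    degreeOf (l, v) (rename (Prod.mk l') p) ≤ degreeOf v p := by
  classical
  by_cases hl : l' = l
  · subst hl
    rw [degreeOf_rename_of_injective (Prod.mk_right_injective l') v]
  · rw [degreeOf_eq_sup, support_rename_of_injective (Prod.mk_right_injective l')]
    refine Finset.sup_le fun d hd => ?_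
    obtain ⟨d₀, -, rfl⟩ := Finset.mem_image.mp hd
    rw [Finsupp.mapDomain_notin_range]
    · exact Nat.zero_le _
    · rintro ⟨w, hw⟩
      exact hl (Prod.mk.inj hw).1

/-- Individual degrees of the sum of `k` embedded copies: `deg_{(l, v)} (Σ_{l'} p^{(l')}) ≤ deg_v p`.
[cite: MediniShpilka2021, Def 19 (arXiv p0006:L65)] -/
theorem degreeOf_sum_rename_prodMk_le (l : Fin k) (v : τ) (p : MvPolynomial τ K) :
    degreeOf (l, v) (∑ l' : Fin k, rename (Prod.mk l') p) ≤ degreeOf v p := by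
  classical
  refine (degreeOf_sum_le _ _ _).trans (Finset.sup_le fun l' _ => ?_)
  exact degreeOf_rename_prodMk_le l l' v p

/-- `k` variable-disjoint copies of a `1`-independent block form a `k`-independent map (Def 19).
[cite: MediniShpilka2021, Def 19 and Obs 3.3 (arXiv p0006:L65, p0017:L29)] -/
theorem isIndependent_sum_rename_prodMk {t : ℕ} (g : Fin n → MvPolynomial (Fin t ⊕ Unit) K)
    (hg : IsOneIndependent g) :
    IsIndependent k (fun j => ∑ l : Fin k, rename (Prod.mk l) (g j)) :=
  ⟨fun _ => g, fun _ => hg, fun _ => rfl⟩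

end Blocks

end MS2021

/-! ### The corollary -/

section Cor34

open MS2021 HittingSets

/-- The size arithmetic: `(2n²)^{3(L+2)} ≤ n^{64(L+1)} + 64` for `n ≥ 1`, `L = ⌊log₂ n⌋`.
[folklore] -/
private theorem grid_card_le (n : ℕ) (hn : 1 ≤ n) :
    (2 * n ^ 2) ^ (3 * (Nat.log 2 n + 2)) ≤ n ^ (64 * (Nat.log 2 n + 1)) + 64 := by
  rcases Nat.lt_or_ge n 2 with h1 | h2
  · obtain rfl : n = 1 := by omega
    rw [Nat.log_one_right]
    norm_num
  · have h2n : 2 * n ^ 2 ≤ n ^ 3 := by nlinarith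
    calc (2 * n ^ 2) ^ (3 * (Nat.log 2 n + 2))
        ≤ (n ^ 3) ^ (3 * (Nat.log 2 n + 2)) := Nat.pow_le_pow_left h2n _
      _ = n ^ (9 * (Nat.log 2 n + 2)) := by rw [← pow_mul]; ring_nf
      _ ≤ n ^ (64 * (Nat.log 2 n + 1)) := Nat.pow_le_pow_right hn (by omega)
      _ ≤ n ^ (64 * (Nat.log 2 n + 1)) + 64 := Nat.le_add_right _ _

/-- **MS Cor 34 holds** (arXiv ‹cor:PITROPINV›), in the typed existence-and-size form with `c = 64`:
over every field with `|F| ≥ n²` (or infinite) there is a set of at most `n^{64(⌊log₂ n⌋+1)} + 64`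
points hitting every `0 ≠ f ∈ ROF^{GLaff_n(F)}` — the grid values of `⌊log₂ n⌋ + 2` variable-disjoint
copies of the uniform SV block (Thm 33 for every leaf count `m ≤ n < 2^{⌊log₂ n⌋+1}` + Obs 1.14).
[cite: MediniShpilka2021, Cor 34 (CCC p.19:13) and its proof (arXiv §5.1 p0026:L48); Def 3.4; Obs 18 = arXiv Obs 1.14] -/
theorem MS2021_cor_34_holds : MS2021_cor_34 := by
  classical
  refine ⟨64, fun K _ n hK => ?_⟩
  rcases Nat.eq_zero_or_pos n with rfl | hn
  · refine ⟨∅, by simp, fun f hf _ => ?_⟩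
    obtain ⟨m, S, g, hg, h, -⟩ := hf
    have hm : m = 0 := Nat.le_zero.mp h
    subst hm
    obtain ⟨i, -⟩ := hg.nonempty
    exact i.elim0
  -- a pool of at least `n²` and at least `2` field elements
  obtain ⟨U, hU1, hU2⟩ : ∃ U : Finset K, n ^ 2 ≤ U.card ∧ 2 ≤ U.card := by
    rcases hK with hinf | hcard
    · obtain ⟨s, hs⟩ := Infinite.exists_subset_card_eq K (n ^ 2 + 2)
      exact ⟨s, by omega, by omega⟩
    · have hn2 : 0 < n ^ 2 := pow_pos hn 2
      haveI : Finite K := Nat.finite_of_card_ne_zero (by omega)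
      letI := Fintype.ofFinite K
      refine ⟨Finset.univ, ?_, ?_⟩
      · rwa [Finset.card_univ, ← Nat.card_eq_fintype_card]
      · rw [Finset.card_univ]; exact Fintype.one_lt_card
  obtain ⟨k, rfl⟩ : ∃ k, n = k + 1 := ⟨n - 1, by omega⟩
  -- `W` : `n(n-1)+1` elements (control variables), `Wz` : `n+1` elements (the `z`-variables)
  obtain ⟨W, hWU, hW⟩ := Finset.exists_subset_card_eq (s := U) (n := (k + 1) * k + 1) (by nlinarith)
  obtain ⟨Wz, -, hWz⟩ := Finset.exists_subset_card_eq (s := U) (n := k + 2)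
    (by rcases Nat.eq_zero_or_pos k with rfl | hk <;> nlinarith)
  -- `n` distinct field elements `α`
  obtain ⟨T, -, hT⟩ := Finset.exists_subset_card_eq (s := W) (n := k + 1) (by nlinarith)
  let α : Fin (k + 1) ↪ K :=
    ⟨fun i => ((T.equivFin.symm (Fin.cast hT.symm i) : T) : K), fun i i' h =>
      Fin.cast_injective _ (T.equivFin.symm.injective (Subtype.val_injective h))⟩
  -- the number of blocks: `B = ⌊log₂ n⌋ + 2 = t + 1` with `n < 2^t`
  set L := Nat.log 2 (k + 1) with hL
  have hnlt : k + 1 < 2 ^ (L + 1) := Nat.lt_pow_succ_log_self (by norm_num) (k + 1)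
  -- the uniform SV block and its `L + 2` variable-disjoint copies
  set g : Fin (k + 1) → MvPolynomial (Fin 2 ⊕ Unit) K := fun j =>
    C (∏ l ∈ Finset.univ.erase j, (α j - α l))⁻¹ * X (Sum.inr ()) *
      ∏ l ∈ Finset.univ.erase j, (X (Sum.inl 0) - C (α l) * X (Sum.inl 1)) with hg
  set G : Fin (k + 1) → MvPolynomial (Fin (L + 1 + 1) × (Fin 2 ⊕ Unit)) K := fun j =>
    ∑ l : Fin (L + 1 + 1), rename (Prod.mk l) (g j) with hG
  have hgind : IsOneIndependent g := fun i => ⟨![α i, 1], fun j => svGenHom₁_spec α g (fun _ => rfl) i j⟩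
  have hGind : IsIndependent (L + 1 + 1) G := isIndependent_sum_rename_prodMk g hgind
  -- the grid
  let S : Fin (L + 1 + 1) × (Fin 2 ⊕ Unit) → Finset K :=
    fun v => Sum.elim (fun _ => W) (fun _ => Wz) v.2
  refine ⟨(Fintype.piFinset S).image fun x => fun i => eval x (G i), ?_, ?_⟩
  · -- size: `∏_v |S v| ≤ (2n²)^{3(L+2)} ≤ n^{64(L+1)} + 64`
    refine Finset.card_image_le.trans ?_
    rw [Fintype.card_piFinset]
    have hSv : ∀ v, (S v).card ≤ 2 * (k + 1) ^ 2 := by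
      rintro ⟨l, s | u⟩
      · show W.card ≤ _; rw [hW]; nlinarith
      · show Wz.card ≤ _; rw [hWz]; nlinarith
    refine (Finset.prod_le_prod' fun v _ => hSv v).trans ?_
    rw [Finset.prod_const, Finset.card_univ]
    have hcard : Fintype.card (Fin (L + 1 + 1) × (Fin 2 ⊕ Unit)) = 3 * (L + 2) := by
      simp only [Fintype.card_prod, Fintype.card_fin, Fintype.card_sum, Fintype.card_unit]
      ring
    rw [hcard]
    exact grid_card_le (k + 1) (by omega)
  · -- hitting: Obs 1.14 on top of Thm 33 (every leaf count)
    intro f hf hf0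
    by_contra hcon
    push Not at hcon
    have hP : bind₁ G f ≠ 0 := by
      obtain ⟨m, S₀, g₀, hg₀, hfm⟩ := hf
      obtain ⟨h, -⟩ := id hfm
      have hS₀ : S₀.card ≤ 2 ^ (L + 1) := by
        have : S₀.card ≤ m := by simpa using Finset.card_le_univ S₀
        omega
      exact bind₁_ne_zero_of_isROP_of_mem_affOrbit hg₀ hS₀ hfm hf0 hGind
    apply hP
    refine MvPolynomial.eq_zero_of_eval_zero_at_prod_finset _ S (fun v => ?_) (fun x hx => ?_)
    · -- individual degrees
      have hdf : f.totalDegree ≤ k + 1 := totalDegree_le_of_mem_rofAffOrbits hf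
      rcases v with ⟨l, v⟩
      have hdeg := fun j => svGenHom₁_degreeOf α g (fun _ => rfl) j
      rcases v with s | u
      · have hr : ∀ j, degreeOf (l, Sum.inl s) (G j) ≤ k := fun j => by
          show degreeOf _ (∑ l' : Fin (L + 1 + 1), rename (Prod.mk l') (g j)) ≤ k
          refine (degreeOf_sum_rename_prodMk_le l _ (g j)).trans ?_
          simpa using (hdeg j).1 s
        have := degreeOf_bind₁_le G _ hr f
        show degreeOf _ (bind₁ G f) < W.card
        rw [hW]
        nlinarith
      · have hr : ∀ j, degreeOf (l, Sum.inr u) (G j) ≤ 1 := fun j => by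
          show degreeOf _ (∑ l' : Fin (L + 1 + 1), rename (Prod.mk l') (g j)) ≤ 1
          refine (degreeOf_sum_rename_prodMk_le l _ (g j)).trans ?_
          obtain rfl : u = () := rfl
          exact (hdeg j).2
        have := degreeOf_bind₁_le G _ hr f
        show degreeOf _ (bind₁ G f) < Wz.card
        rw [hWz]
        omega
    · -- vanishing on the grid
      have hmem : (fun i => eval x (G i)) ∈
          (Fintype.piFinset S).image fun x => fun i => eval x (G i) :=
        Finset.mem_image_of_mem _ (Fintype.mem_piFinset.2 hx)
      have := hcon _ hmem
      show eval₂Hom (RingHom.id K) x (bind₁ G f) = 0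
      rw [eval₂Hom_bind₁]
      exact this

end Cor34

end Literature.Computability.AlgebraicComplexity

end
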